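import Literature.AlgebraicGeometry.Resolution.BlowupChartRsop
import HarnessLib

/-!
# Blowing up part of a regular system of parameters: the transformed ideals on a chart

Topic: `Literature/AlgebraicGeometry/Resolution`. Continuation of `BlowupChartRsop.lean` (node F6
of the chart computation behind de Jong 1996, 2.4, `DeJong1996NormalCrossingsBlowupStep` of
`NormalCrossingsStrictification.lean`). There, for a regular local ring `R` with regular system
of parameters `(c₁, …, c_n, w)`, the chart `B = (R[It])_{(cᵢ t)}` of the blowing up of
`I = (c)`, a prime `𝔓 ⊂ B` over `𝔪_R` and a localisation `L` of `B` at `𝔓`, the family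
`(cᵢ, (e_j)_{j ∈ J}, w)` — `e_j = c_j/cᵢ` the chart generators lying in `𝔓` — is shown to be part
of a regular system of parameters of `L` (`isRsopPart_chartFamily_reesChart`). Here `w = (f, y)`
is split into the coordinates `f₁, …, f_k` of a marked divisor `F = V(∏ fⱼ)` and the rest, the
normal crossings divisor being `Z = V(∏ fⱼ · ∏ cⱼ) ⊇ F` and the centre `C = V(c) ⊆ Z` its
stratum of points with `n` unmarked branches, and we COMPUTE, in `L`, the ideals of the total
transforms (all PROVED, [folklore]):

* `exists_enum_chartGen_mem` — an injective enumeration `jJ` of the indices `j ≠ i` with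
  `e_j ∈ 𝔓` (the strict transforms of the unmarked branches through the point; at most `n - 1`
  of them); `isUnit_algebraMap_chartGen` — the other `e_j` are units of `L`.
* `isRsopPart_chartFamily_marked` — `ζ = (cᵢ, (e_j)_{j ∈ J}, f₁, …, f_k)` is part of a regular
  system of parameters of `L` (a sub-family of the family of `BlowupChartRsop.lean`);
  `isRsopPart_cons_centre_marked` — so is `(cᵢ, f₁, …, f_k)`.
* `algebraMap_prod_centre` — `∏ cⱼ = cᵢⁿ · ∏ e_j` in `L`;
  `radical_map_span_prod_marked_mul_prod_centre` — **the reduced total transform of `Z`**: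
  `√((∏ fⱼ · ∏ cⱼ) L) = (∏ ζ)`, i.e. `V(cᵢ · ∏_{j ∈ J} e_j · ∏ fⱼ)`: a strict normal crossings
  divisor with `1 + #J + k` branches at the point, `#J ≤ n - 1`;
* `radical_map_span_prod_marked_inf_radical_map_span_centre` — **the reduced total transform of
  `F ∪ C`**: `√((∏ fⱼ) L) ∩ √((c) L) = (cᵢ · ∏ fⱼ)` (`(c) B = (cᵢ)`, Stacks 0804), with `1 + k`
  branches;
* `IsRsopPart.exists_injective_associated` — two parts of regular systems of parameters with
  the same product ideal are the same up to order and units (used to let the marked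
  coordinates be arbitrary).

## Sources

* A. J. de Jong, *Smoothness, semi-stability and alterations*, Publ. Math. IHÉS 83 (1996), 2.4
  (p. 55). [DeJong1996]
* The Stacks Project, Tags 0804, 0BIQ. [StacksProject]
-/

noncomputable section

open IsLocalRing HomogeneousLocalization

namespace Literature.AlgebraicGeometry.Resolution

universe u

/-! ## Parts of regular systems of parameters with the same product -/

/-- **Two parts of regular systems of parameters cutting out the same divisor agree up to order
and units**: if `x` and `f` are parts of regular systems of parameters of a local ring with
`(∏ x_t) = (∏ f_s)`, then there is an injective `σ` with `x_t` associated to `f_{σ t}` (each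
`x_t` is a prime dividing `∏ f_s`; distinct `x_t` are non-associated). [folklore] -/
theorem IsRsopPart.exists_injective_associated {R : Type u} [CommRing R] [IsLocalRing R]
    {n k : ℕ} {x : Fin n → R} {f : Fin k → R} (hx : IsRsopPart x) (hf : IsRsopPart f)
    (h : Ideal.span {∏ t, x t} = Ideal.span {∏ s, f s}) :
    ∃ σ : Fin n → Fin k, Function.Injective σ ∧ ∀ t, Associated (x t) (f (σ t)) := by
  have hdvd : ∏ t, x t ∣ ∏ s, f s :=
    Ideal.mem_span_singleton.mp (h ▸ Ideal.mem_span_singleton_self _)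
  have hσ : ∀ t, ∃ s, Associated (x t) (f s) := fun t =>
    hf.exists_associated_of_prime_dvd_prod (hx.prime t)
      ((Finset.dvd_prod_of_mem x (Finset.mem_univ t)).trans hdvd)
  choose σ hσ using hσ
  refine ⟨σ, fun t t' htt' => ?_, hσ⟩
  by_contra hne
  exact hx.not_associated hne ((hσ t).trans (htt' ▸ (hσ t').symm))

/-! ## The chart, a prime over the closed point, and the strict transforms through it -/

section Chart

variable {R : Type u} [CommRing R] [IsRegularLocalRing R] {n k e : ℕ} (c : Fin n → R) (i : Fin n)
  (f : Fin k → R) (y : Fin e → R)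
  (hz : Ideal.span (Set.range (Fin.append c (Fin.append f y))) = maximalIdeal R)
  (hd : (maximalIdeal R).spanFinrank = n + (k + e))
  (𝔓 : Ideal (chartRing c i)) [𝔓.IsPrime] (h𝔓 : 𝔓.comap (chartBase c i) = maximalIdeal R)
  (L : Type u) [CommRing L] [IsLocalRing L] [Algebra (chartRing c i) L]
  [IsLocalization.AtPrime L 𝔓]

/-- The structure map `B → L` (a type-ascribed `algebraMap`, which keeps instance search from
stalling on the chart ring). -/
local notation3 "aL" => (algebraMap (chartRing c i) L : chartRing c i →+* L)

omit [IsRegularLocalRing R] [𝔓.IsPrime] [IsLocalRing L] [IsLocalization.AtPrime L 𝔓] [CommRing L]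
  [Algebra (chartRing c i) L] in
/-- **The strict transforms of the unmarked branches through the point**: an injective
enumeration `jJ` of the indices `j ≠ i` whose chart generator `e_j = c_j/cᵢ` lies in `𝔓`
(exactly those), of length at most `n - 1`. [folklore] -/
theorem exists_enum_chartGen_mem :
    ∃ (a : ℕ) (jJ : Fin a → {j : Fin n // j ≠ i}), Function.Injective jJ ∧
      (∀ t, chartGen c i (jJ t).1 ∈ 𝔓) ∧
      (∀ j : {j : Fin n // j ≠ i}, chartGen c i j.1 ∈ 𝔓 → j ∈ Set.range jJ) ∧ a ≤ n - 1 := by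
  classical
  set T : Finset {j : Fin n // j ≠ i} := Finset.univ.filter fun j => chartGen c i j.1 ∈ 𝔓 with hT
  have hmem : ∀ j, j ∈ T ↔ chartGen c i j.1 ∈ 𝔓 := fun j => by simp [hT]
  refine ⟨T.card, fun t => (T.orderIsoOfFin rfl t : {j : Fin n // j ≠ i}),
    fun _ _ h => (T.orderIsoOfFin rfl).injective (Subtype.ext h),
    fun t => (hmem _).mp (T.orderIsoOfFin rfl t).2, fun j hj => ?_, ?_⟩
  · obtain ⟨t, ht⟩ := (T.orderIsoOfFin rfl).surjective ⟨j, (hmem j).mpr hj⟩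
    exact ⟨t, congrArg Subtype.val ht⟩
  · refine (Finset.card_le_univ _).trans ?_
    rw [Fintype.card_subtype_compl, Fintype.card_fin, Fintype.card_unique]

omit [IsRegularLocalRing R] [IsLocalRing L] in
/-- **The chart generators not in `𝔓` are units of `L`.** [folklore] -/
theorem isUnit_algebraMap_chartGen {j : Fin n} (hj : chartGen c i j ∉ 𝔓) :
    IsUnit (aL (chartGen c i j)) :=
  IsLocalization.map_units L (⟨chartGen c i j, hj⟩ : 𝔓.primeCompl)

/-! ## The family `ζ = (cᵢ, (e_j)_{j ∈ J}, f)` -/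

variable {a : ℕ} (jJ : Fin a → {j : Fin n // j ≠ i}) (hjJ : Function.Injective jJ)
  (hJ : ∀ t, chartGen c i (jJ t).1 ∈ 𝔓)
  (hJ' : ∀ j : {j : Fin n // j ≠ i}, chartGen c i j.1 ∈ 𝔓 → j ∈ Set.range jJ)

omit [IsRegularLocalRing R] [𝔓.IsPrime] [IsLocalRing L] [IsLocalization.AtPrime L 𝔓] in
/-- `chartFamily` for `w = (f, y)` restricted to its first `a + k + 1` members is `chartFamily`
for `w = f` (the `y`-block comes last). [folklore] -/
theorem chartFamily_comp_castLE (hle : a + k + 1 ≤ a + (k + e) + 1) :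
    chartFamily c i (Fin.append f y) L (chartBase c i) (chartGen c i) jJ ∘ Fin.castLE hle =
      chartFamily c i f L (chartBase c i) (chartGen c i) jJ := by
  funext t
  refine Fin.cases ?_ (fun t => ?_) t
  · rfl
  · have h1 : Fin.castLE hle t.succ = (Fin.castLE (by omega) t : Fin (a + (k + e))).succ :=
      Fin.ext (by simp)
    simp only [Function.comp_apply, h1, chartFamily, Fin.cons_succ]
    refine Fin.addCases (fun t => ?_) (fun s => ?_) t
    · have h2 : Fin.castLE (by omega) (Fin.castAdd k t) =
          (Fin.castAdd (k + e) t : Fin (a + (k + e))) := Fin.ext (by simp)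
      rw [h2, Fin.append_left, Fin.append_left]
    · have h2 : Fin.castLE (by omega) (Fin.natAdd a s) =
          (Fin.natAdd a (Fin.castAdd e s) : Fin (a + (k + e))) := Fin.ext (by simp)
      rw [h2, Fin.append_right, Fin.append_right, Fin.append_left]

include hz hd h𝔓 hjJ hJ in
/-- **`ζ = (cᵢ, (e_j)_{j ∈ J}, f)` is part of a regular system of parameters of `L`** (a
sub-family of `(cᵢ, e_J, f, y)`, `isRsopPart_chartFamily_reesChart`).
[cite: DeJong1996, 2.4, p. 55] -/
theorem isRsopPart_chartFamily_marked :
    IsRsopPart (chartFamily c i f L (chartBase c i) (chartGen c i) jJ) := by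
  have h := isRsopPart_chartFamily_reesChart c i (Fin.append f y) hz hd 𝔓 h𝔓 L jJ hjJ hJ
  have hle : a + k + 1 ≤ a + (k + e) + 1 := by omega
  have := h.comp (Fin.castLE hle) (Fin.castLE_injective hle)
  rwa [chartFamily_comp_castLE] at this

include hz hd h𝔓 in
/-- **`(cᵢ, f₁, …, f_k)` is part of a regular system of parameters of `L`.** [folklore] -/
theorem isRsopPart_cons_centre_marked :
    IsRsopPart (Fin.cons (aL (chartBase c i (c i)))
      (fun s => aL (chartBase c i (f s))) : Fin (k + 1) → L) := by
  obtain ⟨a, jJ, hjJ, hJ, -, -⟩ := exists_enum_chartGen_mem c i 𝔓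
  have h := (isRsopPart_chartFamily_marked c i f y hz hd 𝔓 h𝔓 L jJ hjJ hJ).comp
    (Fin.cons 0 fun s : Fin k => Fin.succ (Fin.natAdd a s))
    (by
      intro t t' htt'
      induction t using Fin.cases with
      | zero =>
        induction t' using Fin.cases with
        | zero => rfl
        | succ t' =>
          simp only [Fin.cons_zero, Fin.cons_succ] at htt'
          exact absurd htt'.symm (Fin.succ_ne_zero _)
      | succ t =>
        induction t' using Fin.cases with
        | zero =>
          simp only [Fin.cons_zero, Fin.cons_succ] at htt'
          exact absurd htt' (Fin.succ_ne_zero _)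
        | succ t' =>
          simp only [Fin.cons_succ, Fin.succ_inj] at htt'
          rw [Fin.natAdd_inj] at htt'
          rw [htt'])
  convert h using 1
  funext t
  refine Fin.cases ?_ (fun s => ?_) t
  · simp [chartFamily]
  · simp [chartFamily, Fin.append_right]

/-! ## The total transforms -/

omit [IsRegularLocalRing R] [𝔓.IsPrime] [IsLocalRing L] [IsLocalization.AtPrime L 𝔓] in
/-- **`∏ cⱼ = cᵢⁿ · ∏ e_j` in `L`** (`c_j = cᵢ e_j` in the chart, `e_i = 1`).
[cite: StacksProject, Tag 0804] -/
theorem algebraMap_prod_centre :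
    aL (chartBase c i (∏ j, c j)) =
      aL (chartBase c i (c i)) ^ n * ∏ j, aL (chartGen c i j) := by
  rw [map_prod, map_prod]
  conv_lhs =>
    arg 2
    ext j
    rw [reesChartBase_apply_eq_mul_chartGen c i j, map_mul]
  rw [Finset.prod_mul_distrib, Finset.prod_const, Finset.card_univ, Fintype.card_fin]

omit [IsRegularLocalRing R] [IsLocalRing L] in
include hjJ hJ' in
/-- **`∏_j e_j = U · ∏_{j ∈ J} e_j` with `U` a unit of `L`** (the `e_j` off `J` are units, and
`e_i = 1`). [folklore] -/
theorem exists_isUnit_prod_chartGen_eq :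
    ∃ U : L, IsUnit U ∧ ∏ j, aL (chartGen c i j) = U * ∏ t, aL (chartGen c i (jJ t).1) := by
  classical
  set g : Fin n → L := fun j => aL (chartGen c i j) with hg
  set T : Finset {j : Fin n // j ≠ i} := Finset.univ.image jJ with hT
  -- remove `e_i = 1` and pass to the index type `{j // j ≠ i}`
  have h1 : ∏ j, g j = ∏ j : {j : Fin n // j ≠ i}, g j.1 := by
    rw [← Finset.mul_prod_erase Finset.univ g (Finset.mem_univ i)]
    have hi : g i = 1 := by
      have hii : chartGen c i i = 1 := chartGen_self c i
      simp only [hg]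
      rw [hii, map_one]
    rw [hi, one_mul]
    refine Finset.prod_subtype _ (fun j => ?_) _
    simp [Finset.mem_erase]
  -- split along `J = range jJ` and its complement
  have h2 := Finset.prod_mul_prod_compl T fun j : {j : Fin n // j ≠ i} => g j.1
  have h3 : ∏ j ∈ T, g j.1 = ∏ t, g (jJ t).1 := by
    rw [hT, Finset.prod_image fun t _ t' _ h => hjJ h]
  refine ⟨∏ j ∈ Tᶜ, g j.1, ?_, ?_⟩
  · refine Finset.prod_induction _ IsUnit (fun a b ha hb => ha.mul hb) isUnit_one fun j hj => ?_
    rw [Finset.mem_compl] at hj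
    refine isUnit_algebraMap_chartGen c i 𝔓 L fun hmem => hj ?_
    obtain ⟨t, rfl⟩ := hJ' j hmem
    exact Finset.mem_image_of_mem jJ (Finset.mem_univ t)
  · rw [h1, ← h2, h3, mul_comm]

include hz hd h𝔓 hjJ hJ hJ' in
/-- **The reduced total transform of `Z = V(∏ fⱼ · ∏ cⱼ)` at the point is `V(∏ ζ)`**:
`√((∏ fⱼ · ∏ cⱼ) L) = (cᵢ · ∏_{j ∈ J} e_j · ∏ fⱼ)` — in `L`,
`∏ fⱼ · ∏ cⱼ = U · cᵢⁿ · ∏_J e_j · ∏ fⱼ`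
with `U` a unit, and `√(U ∏ ζ_t^{a_t}) = (∏ ζ_t)` for the part `ζ` of a regular system of
parameters (`IsRsopPart.radical_span_unit_mul_prod_pow`; needs `n ≥ 1`).
[cite: DeJong1996, 2.4, p. 55] -/
theorem radical_map_span_prod_marked_mul_prod_centre (hn : 0 < n) :
    ((Ideal.span {(∏ s, f s) * ∏ j, c j}).map ((aL).comp (chartBase c i))).radical =
      Ideal.span {∏ t, chartFamily c i f L (chartBase c i) (chartGen c i) jJ t} := by
  obtain ⟨U, hU, hprod⟩ := exists_isUnit_prod_chartGen_eq c i 𝔓 L jJ hjJ hJ'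
  -- exponents: `n` on `cᵢ`, `1` elsewhere
  let ex : Fin (a + k + 1) → ℕ := Fin.cons n fun _ => 1
  have hex : ∀ t, 0 < ex t := fun t => Fin.cases hn (fun _ => Nat.one_pos) t
  have key : ((aL).comp (chartBase c i)) ((∏ s, f s) * ∏ j, c j) =
      U * ∏ t, chartFamily c i f L (chartBase c i) (chartGen c i) jJ t ^ ex t := by
    rw [Fin.prod_univ_succ]
    simp only [ex, Fin.cons_zero, Fin.cons_succ, pow_one, RingHom.comp_apply, map_mul]
    rw [algebraMap_prod_centre, hprod, map_prod, map_prod, chartFamily, Fin.cons_zero]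
    simp only [Fin.cons_succ]
    rw [Fin.prod_univ_add]
    simp only [Fin.append_left, Fin.append_right]
    ring
  rw [Ideal.map_span, Set.image_singleton, key]
  exact (isRsopPart_chartFamily_marked c i f y hz hd 𝔓 h𝔓 L jJ hjJ
    hJ).radical_span_unit_mul_prod_pow hU ex hex

include hz hd h𝔓 in
/-- **The reduced total transform of `F ∪ C` at the point is `V(cᵢ · ∏ fⱼ)`**:
`√((∏ fⱼ) L) ∩ √((c) L) = (cᵢ · ∏ fⱼ)` — `(c) B = (cᵢ)` (Stacks 0804), both ideals are radical
(`cᵢ` and the `fⱼ` being part of one regular system of parameters of `L`), and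
`(∏ fⱼ) ∩ (cᵢ) = (cᵢ ∏ fⱼ)` (`IsRsopPart.span_prod_inf_span_range`).
[cite: DeJong1996, 2.4, p. 55] -/
theorem radical_map_span_prod_marked_inf_radical_map_span_centre :
    ((Ideal.span {∏ s, f s}).map ((aL).comp (chartBase c i))).radical ⊓
      ((Ideal.span (Set.range c)).map
        ((aL).comp (chartBase c i))).radical =
      Ideal.span {aL (chartBase c i (c i)) * ∏ s, aL (chartBase c i (f s))} := by
  have hcf := isRsopPart_cons_centre_marked c i f y hz hd 𝔓 h𝔓 L
  -- the marked part `(f)` and the pair `(f ; cᵢ)` as parts of regular systems of parameters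
  have hf : IsRsopPart (fun s => aL (chartBase c i (f s))) := by
    have := hcf.comp Fin.succ (Fin.succ_injective _)
    simpa [Function.comp_def] using this
  have hfc : IsRsopPart (Fin.append (fun s => aL (chartBase c i (f s)))
      (fun _ : Fin 1 => aL (chartBase c i (c i)))) := by
    have := hcf.comp (Fin.append Fin.succ (fun _ : Fin 1 => 0)) (by
      intro t t' h
      induction t using Fin.addCases with
      | left t =>
        induction t' using Fin.addCases with
        | left t' => simpa [Fin.append_left] using h
        | right s' =>
          simp only [Fin.append_left, Fin.append_right] at h
          exact absurd h (Fin.succ_ne_zero _)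
      | right s =>
        induction t' using Fin.addCases with
        | left t' =>
          simp only [Fin.append_left, Fin.append_right] at h
          exact absurd h.symm (Fin.succ_ne_zero _)
        | right s' => exact congrArg _ (Subsingleton.elim s s'))
    convert this using 1
    funext t
    refine Fin.addCases (fun t => ?_) (fun s => ?_) t
    · simp [Fin.append_left]
    · simp [Fin.append_right]
  -- `(∏ f) L` and `(c) L = (cᵢ) L` are radical
  have h1 : (Ideal.span {∏ s, f s}).map ((aL).comp (chartBase c i)) =
      Ideal.span {∏ s, aL (chartBase c i (f s))} := by
    rw [Ideal.map_span, Set.image_singleton, map_prod]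
    rfl
  have h2 : (Ideal.span (Set.range c)).map ((aL).comp (chartBase c i)) =
      Ideal.span {aL (chartBase c i (c i))} := by
    rw [← Ideal.map_map, show (Ideal.span (Set.range c)).map (chartBase c i) =
        Ideal.span {chartBase c i (c i)} from span_image_reesChartBase_eq (c i) _,
      Ideal.map_span, Set.image_singleton]
  have hprime : Prime (aL (chartBase c i (c i))) := by
    have := hcf.prime 0
    simpa using this
  rw [h1, h2, hf.isRadical_span_prod.radical,
    ((Ideal.span_singleton_prime hprime.ne_zero).mpr hprime).isRadical.radical]
  have h3 := hfc.span_prod_inf_span_range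
  rw [Set.range_const] at h3
  rw [h3, Ideal.span_singleton_mul_span_singleton, mul_comm]

end Chart

end Literature.AlgebraicGeometry.Resolution

end
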